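import Summits.QuantumAdvantage.QuantumAdvantage.Theorems.SosSandwichTransferPBEventOSMRepr
import Summits.QuantumAdvantage.QuantumAdvantage.Theorems.SosSandwichTransferPBEventOSMFP
import Summits.QuantumAdvantage.QuantumAdvantage.Theorems.SosSandwichTransferPBEventMachineOSM
import HarnessLib

/-!
# Crux `TransferPB` (stmt-QuantumAdvantage-15238, route SosSandwich), line `birth` — THE MACHINE HALF IS DONE: the stub from (Q) alone

Final assembly of the machine half of stub `stub_pbOracleSimulation`:

* `length_rec8`, `length_encList_cons`, `length_encList_append_singleton`, `length_encPathS_append_singleton`,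
  `length_encOpt_bump_le`, `length_encOpt_le`, `length_encSt_finish_le`, `length_encSt_proceed_le`,
  **`length_encSt_evDelta_le`** — on states satisfying the size invariant `EvInv W D` the transition grows the state
  code by at most `8W + 16` (so the cap of `delF pw (8·pw+16)` is inactive there);
* **`delF_encSt`** — the capped transition codes `evDelta (pw |x|)` on such states;
* **`eventOSM_spec`** — hypothesis (E) of `stub_pbOracleSimulation_of_eventOSM`
  (`Theorems/SosSandwichTransferPBEventMachineOSM.lean`) holds for all polynomials `pw, pd`, witnessed by
  `evOSM pw pd (8·pw + 16)` and the state code `encSt`;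
* **`stub_pbOracleSimulation_of_Q`** — the registered stub `Sig.stub_pbOracleSimulation` follows from
  (Q) `∀ c k F uniform r, nodeProblem F r c k ∈ PromiseBQP` ALONE: the transcript machine is the event-driven state
  machine, polynomial time by `OSM.isPolyTime_alg`, correct runs and short queries by
  `Theorems/SosSandwichTransferPBEventMachine{,Inv,OSM}.lean`.

What remains for the stub (and hence for crux `TransferPB`, whose other two stubs are closed) is (Q): the promise-BQP
membership of the gapped BLOCK/SINGLE query-magnitude tests and MEAN thresholds (`nodeProblem`,
`Theorems/SosSandwichTransferPBMachineDefs.lean`). All proved here; (Q) is a plain `Prop` argument (no named fact).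
Sources: S. Aaronson, A. Ambainis, Theory Comput. 10 (2014), proof of Thm. 23 (p. 14); S. Arora, B. Barak,
Computational Complexity (CUP 2009), §3.4, §1.3.
-/

-- D-0017: single-conjunct summit ⇒ the duplicate `QuantumAdvantage.QuantumAdvantage` is mandated.
set_option linter.dupNamespace false

noncomputable section

namespace Summit.QuantumAdvantage.QuantumAdvantage.Cruxes.TransferPB.Birth

open Finset Literature.Computability.Cryptography Literature.Computability.Complexity
  Literature.Computability.QuantumComplexity Literature.Computability.QuantumComplexity.ClassicalSimulation
open Brick Plumb

namespace SimTreePB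

namespace EvOSM

section Growth

/-- Length of an eight-field record. [folklore] -/
@[simp] theorem length_rec8 (a₀ a₁ a₂ a₃ a₄ a₅ a₆ a₇ : List Bool) :
    (rec8 a₀ a₁ a₂ a₃ a₄ a₅ a₆ a₇).length =
      2 * (a₀.length + a₁.length + a₂.length + a₃.length + a₄.length + a₅.length + a₆.length) + 14 + a₇.length := by
  simp [rec8, length_boolPair]; omega

/-- Length of a coded nonempty list. [folklore] -/
@[simp] theorem length_encList_cons (a : List Bool) (l : List (List Bool)) :
    (encList (a :: l)).length = 2 * a.length + 2 + (encList l).length := by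
  simp [encList_cons]

/-- Length of a coded list with an item appended. [folklore] -/
@[simp] theorem length_encList_append_singleton (l : List (List Bool)) (a : List Bool) :
    (encList (l ++ [a])).length = (encList l).length + (2 * a.length + 2) := by
  rw [encList_append]; simp [encList_cons]

/-- Length of a serialised path with an entry appended. [folklore] -/
@[simp] theorem length_encPathS_append_singleton (π : List (List Bool × Bool)) (u : List Bool) (b : Bool) :
    (encPathS (π ++ [(u, b)])).length = (encPathS π).length + (2 * u.length + 4) := by
  rw [encPathS_append_singleton]; simp; omega

/-- The option code of the updated candidate grows by at most `|u| + 1`. [folklore] -/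
theorem length_encOpt_bump_le (π : List (List Bool × Bool)) (b : Bool) (best : Option (List Bool)) (u : List Bool) :
    (encOpt (bump π b best u)).length ≤ (encOpt best).length + u.length + 1 := by
  rcases bump_eq_or π b best u with h | h <;> rw [h]
  · omega
  · simp [encOpt]

/-- The option code of a short candidate is short. [folklore] -/
theorem length_encOpt_le {best : Option (List Bool)} {W : ℕ} (hbest : ∀ c, best = some c → c.length < W) :
    (encOpt best).length ≤ W := by
  cases best with
  | none => simp [encOpt]
  | some c => have := hbest c rfl; simp [encOpt]; omega

/-- Length of the code of `finish`. [folklore] -/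
theorem length_encSt_finish_le {π : List (List Bool × Bool)} {d W : ℕ} {best : Option (List Bool)}
    (hbest : ∀ c, best = some c → c.length < W) :
    (encSt (finish π d best)).length ≤
      2 * (encPathS π).length + 2 * (encList (π.map Prod.fst)).length + 2 * d + 2 * W + 20 := by
  cases best with
  | none => simp [finish, encSt, tMeans, ones]; omega
  | some c => have := hbest c rfl; simp [finish, encSt, tAq]; omega

/-- Length of the code of `proceed`. [folklore] -/
theorem length_encSt_proceed_le {π : List (List Bool × Bool)} {d lv W : ℕ} {rest next : List (List Bool)}
    {best : Option (List Bool)} (hbest : ∀ c, best = some c → c.length < W) :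
    (encSt (proceed π d lv rest next best)).length ≤
      2 * (encPathS π).length + 2 * (encList (π.map Prod.fst)).length + 2 * d + 2 * lv + 2 * (encList rest).length +
        2 * (encList next).length + (encOpt best).length + 2 * W + 20 := by
  rcases rest with _ | ⟨w, rest⟩
  · rcases lv with _ | lv
    · have := length_encSt_finish_le (π := π) (d := d) hbest
      simp only [proceed]; omega
    · rcases next with _ | ⟨v, next⟩
      · have := length_encSt_finish_le (π := π) (d := d) hbest
        simp only [proceed]; omega
      · simp [proceed, encSt, tSingle]; omega
  · simp [proceed, encSt, tSingle]; omega

/-- **The transition grows the state code additively**: by at most `8W + 16` on states satisfying the size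
invariant `EvInv W D`. [folklore] -/
theorem length_encSt_evDelta_le {W D : ℕ} {s : EvState} (hs : EvInv W D s) (b : Bool) :
    (encSt (evDelta W s b)).length ≤ (encSt s).length + (8 * W + 16) := by
  obtain ⟨hπ, hlen, hph⟩ := hs
  rcases s with ⟨π, d, phase⟩
  simp only at hπ hlen hph
  cases phase with
  | root =>
    have hδ : evDelta W ⟨π, d, .root⟩ b = if W = 0 then finish π d none
        else if b = true then ⟨π, d, .single (W - 1) [[]] [] none⟩ else finish π d none := rfl
    rw [hδ]
    have hf := length_encSt_finish_le (π := π) (d := d) (best := none) (W := W) (by simp)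
    split_ifs with hW hb
    · refine hf.trans ?_
      simp [encSt, tRoot]; omega
    · simp [encSt, tRoot, tSingle, encOpt]; omega
    · refine hf.trans ?_
      simp [encSt, tRoot]; omega
  | single lv alive next best =>
    obtain ⟨hd, halive, hnext, hbest⟩ := hph
    rcases alive with _ | ⟨u, rest⟩
    · rcases lv with _ | lv <;> exact Nat.le_add_right _ _
    · have hu := halive u (by simp)
      have hbump := length_encOpt_bump_le π b best u
      have hbest' : ∀ c, bump π b best u = some c → c.length < W := by
        intro c hc
        rcases bump_eq_or π b best u with h | h
        · exact hbest c (h ▸ hc)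
        · rw [h] at hc; cases hc; omega
      rcases lv with _ | lv
      · refine (length_encSt_proceed_le (π := π) (d := d) (lv := 0) (rest := rest) (next := next) hbest').trans ?_
        simp [encSt, tSingle]; omega
      · show (encSt ⟨π, d, .block0 (lv + 1) (u :: rest) next (bump π b best u)⟩).length ≤ _
        simp [encSt, tSingle, tBlock0]; omega
  | block0 lv alive next best =>
    obtain ⟨hd, halive, hnext, hbest⟩ := hph
    rcases alive with _ | ⟨u, rest⟩
    · exact Nat.le_add_right _ _
    · have hu := halive u (by simp)
      show (encSt ⟨π, d, .block1 lv (u :: rest) (if b = true then next ++ [u ++ [false]] else next) best⟩).length ≤ _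
      cases b
      · simp [encSt, tBlock0, tBlock1]
      · simp [encSt, tBlock0, tBlock1]; omega
  | block1 lv alive next best =>
    obtain ⟨hd, halive, hnext, hbest⟩ := hph
    rcases alive with _ | ⟨u, rest⟩
    · exact Nat.le_add_right _ _
    · have hu := halive u (by simp)
      show (encSt (proceed π d lv rest (if b = true then next ++ [u ++ [true]] else next) best)).length ≤ _
      have hbW := length_encOpt_le hbest
      refine (length_encSt_proceed_le (π := π) (d := d) (lv := lv) (rest := rest) hbest).trans ?_
      cases b <;> (simp [encSt, tBlock1]; omega)
  | aq u =>
    obtain ⟨hd, hu⟩ := hph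
    have hδ : evDelta W ⟨π, d, .aq u⟩ b = roundState (π ++ [(u, b)]) (d - 1) := rfl
    rw [hδ]
    rcases hd1 : d - 1 with _ | d'
    · simp [roundState, encSt, tAq, tMeans, List.map_append]; omega
    · simp [roundState, encSt, tAq, tRoot, List.map_append]; omega
  | means j cnt =>
    have hδ : evDelta W ⟨π, d, .means j cnt⟩ b =
        if 40 ≤ j then ⟨π, d, .done (decide (20 ≤ (if b = true then cnt + 1 else cnt)))⟩
        else ⟨π, d, .means (j + 1) (if b = true then cnt + 1 else cnt)⟩ := rfl
    rw [hδ]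
    split_ifs <;> cases b <;> (simp [encSt, tMeans, tDone]; omega)
  | done c => exact Nat.le_add_right _ _

end Growth

section Assembly

open Summit.QuantumAdvantage.QuantumAdvantage.Theses.SosSandwich

/-- The cap polynomial `8·pw + 16`. -/
theorem capPoly_eval (pw : Polynomial ℕ) (n : ℕ) :
    (Polynomial.C 8 * pw + Polynomial.C 16).eval n = 8 * pw.eval n + 16 := by simp

/-- **The capped transition codes `evDelta`** on states satisfying the size invariant (the cap is inactive there).
[folklore] -/
theorem delF_encSt (pw : Polynomial ℕ) (x : List Bool) {D : ℕ} {s : EvState} (hs : EvInv (pw.eval x.length) D s)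
    (b : Bool) :
    delF pw (Polynomial.C 8 * pw + Polynomial.C 16) (dArg x (encSt s) b) = encSt (evDelta (pw.eval x.length) s b) := by
  rw [delF, capDel_dArg_eq, del0_encSt]
  rw [del0_encSt, capPoly_eval]
  exact length_encSt_evDelta_le hs b

/-- **Hypothesis (E) of `stub_pbOracleSimulation_of_eventOSM` holds**: for all polynomials `pw, pd` the state machine
`evOSM pw pd (8·pw + 16)` has `FP` maps of additive growth coding the event machine. [cite: AroraBarak2009, §3.4, §1.3] -/
theorem eventOSM_spec (pw pd : Polynomial ℕ) :
    ∃ (S : OSM) (enc : List Bool → EvState → List Bool) (G : Polynomial ℕ),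
      S.ini ∈ FP ∧ S.del ∈ FP ∧ S.kap ∈ FP ∧
      (∀ (x st : List Bool) (b : Bool), (S.del (boolPair x (boolPair st [b]))).length ≤ st.length + G.eval x.length) ∧
      (∀ x : List Bool, S.ini x = enc x (evInit (pd.eval x.length))) ∧
      (∀ (x : List Bool) (s : EvState) (b : Bool), EvInv (pw.eval x.length) (pd.eval x.length) s →
        S.del (boolPair x (boolPair (enc x s) [b])) = enc x (evDelta (pw.eval x.length) s b)) ∧
      (∀ (x : List Bool) (s : EvState), EvInv (pw.eval x.length) (pd.eval x.length) s →
        S.kap (boolPair x (enc x s)) = Sum.elim (fun q => false :: q) (fun b => [true, b]) (evKappa x s)) :=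
  ⟨evOSM pw pd (Polynomial.C 8 * pw + Polynomial.C 16), fun _ => encSt, Polynomial.C 8 * pw + Polynomial.C 16,
    iniF_mem_FP pd, delF_mem_FP _ _, kapF_mem_FP,
    fun x st b => length_capDel_dArg_le _ _ x st b,
    fun x => iniF_apply x pd,
    fun x _ b hs => delF_encSt pw x hs b,
    fun x s _ => kapF_encSt x s⟩

/-- **The machine half of stub `stub_pbOracleSimulation` is DONE: the registered stub follows from (Q) alone** —
`∀ c k F uniform r, nodeProblem F r c k ∈ PromiseBQP` (the promise-BQP membership of the gapped BLOCK/SINGLE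
magnitude tests and MEAN thresholds, `Theorems/SosSandwichTransferPBMachineDefs.lean`). The transcript machine is the
event-driven state machine `(evOSM pw pd (8pw+16)).alg.mapOut decodeBool`: polynomial time by `OSM.isPolyTime_alg`, runs and
query lengths by `Theorems/SosSandwichTransferPBEventMachine{,Inv,OSM}.lean`. [cite: AaronsonAmbainis2014, Thm. 23 (proof, p. 14)] -/
theorem stub_pbOracleSimulation_of_Q
    (hQ : ∀ (c k : ℕ) (F : QCircuitFamily cliffordT), F.IsUniform → ∀ r : Polynomial ℕ,
      nodeProblem F r c k ∈ Literature.Computability.Cryptography.PromiseBQP) :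
    Sig.stub_pbOracleSimulation :=
  stub_pbOracleSimulation_of_eventOSM hQ eventOSM_spec

end Assembly

end EvOSM

end SimTreePB

end Summit.QuantumAdvantage.QuantumAdvantage.Cruxes.TransferPB.Birth

end
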